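import Summits.Ventures.QEC.Census.CertCheckBZFast
import Summits.Ventures.QEC.Census.BB.BB144.BZAut4Data
import HarnessLib

/-!
# `BB144` — `bz_aut` certificate `bzAut4Data` (certA 27af9174ef991c5e, qec-search-10 4-block translation-orbit cover), side Z: KERNEL enumeration verdicts, file 03 (block 0, matrix 1, depth 5,
# part 2/9; emitted by qec-search-10 emit_std_enum.py in the cell-standard fast shape of qec-type-08's `Census/CertCheckBZFast.lean`)

Level-1 chunk ranges of the Brouwer–Zimmermann replay of matrix `G_1` of block 0 (first rows `i0 … i0+len−1`, budget 4 after
the first row): `chunk1RF (BB144.cert.bzTestZW wtGt11U) (BB144.cert.bzPosZ BB144.bzAut4Data 0 1) 4 i0 len = true` by `decide +kernel`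
(`maxHeartbeats 400000000` per declaration, director R12; ≤ 2000000 codewords per theorem and per file, type-08 01:05:18Z).
The fast scan `chunk1RF` and the unrolled weight test `wtGt11U` are EQUAL to the tree's `chunk1R` / `bzTestZ` (bridges
`chunk1RF_eq`, `bzTestZW_eq wtGt11U_eq`), so every theorem here is a statement about type-10's own words. Tier KERNEL-std,
axioms standard.
-/

namespace Summit.Ventures.QEC.Census.BB144

set_option maxHeartbeats 400000000 in
/-- Block 0, matrix 1, first rows 1 … 2 (budget 4 after the first row; 1893432 codewords): pass (fast scan, kernel). -/
theorem enum4Z_0_1_r1 : chunk1RF (BB144.cert.bzTestZW wtGt11U) (BB144.cert.bzPosZ BB144.bzAut4Data 0 1) 4 1 2 = true := by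
  decide +kernel

end Summit.Ventures.QEC.Census.BB144
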